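import Literature.NumberTheory.EllipticCurves.BSDSelmerParityDokchitserBaseChangeProofs
import Literature.NumberTheory.EllipticCurves.ComplexMultiplicationShaRubinGZKProofs
import Literature.NumberTheory.EllipticCurves.SelmerTrivialCorankProofs
import HarnessLib

/-!
# Route `KolyvaginRoadThree`, crux `ZhangSharpFrameAtThreeHL` (item stmt-BirchSwinnertonDyer-19574), stub S1 on RATIONAL lifts:
# the SELMER DESCENT `K → ℚ` at an odd prime (cell `bsd-stepL`, seat `bsd-stepL-koly3b` g9)

The E′-side residual of S1's first floor on a rational level-raised frame (koly3b g8,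
`KolyvaginRoadThreeRationalLiftDefiniteUnitValue.lean`, hypothesis `hGV`) starts from the KERNEL
statement `Sel₃(E′/K) = 0` (GP2@3-RATIONAL, `selmerGroup_eq_bot_of_rationalLift_of_kill_of_mult`) and
must feed the rank-`0` inputs that print states over `ℚ` (Skinner 2016 Thm. C, clauses (1) and (2),
for `E′` and for its twist `E′^{(d_K)}`; W. Zhang 2014 Thm. 7.1 cites [SU] Thm. 2 for `A` and `A^K`).
This file proves the bridge, FACT-FREE (theorems only; standard axioms):

* `selmerGroupPInfty_eq_bot_of_forall_nsmul_eq_zero`, `selmerGroupPInfty_eq_bot_of_selmerGroup_eq_bot` —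
  over any number field `F`: `Sel^{(p)}(E/F) = 0 ⟹ Sel_{p^∞}(E/F) = 0` (`Sel^{(p)} ↠ Sel_{p^∞}[p]`,
  tree `exists_mem_selmerGroup_torsionToPrimaryH1_eq`, and `Sel_{p^∞}` is `p`-primary);
* `selmerGroupPInfty_eq_bot_of_baseChange`, `selmerGroupPInfty_quadraticTwist_eq_bot_of_baseChange`,
  `selmerGroupPInfty_quadraticTwist_discr_eq_bot_of_baseChange` — for `E/ℚ`, `K = ℚ(θ)` quadratic with
  `θ² = c` and an ODD prime `p`: `Sel_{p^∞}(E/K) = 0 ⟹ Sel_{p^∞}(E/ℚ) = 0 ∧ Sel_{p^∞}(E^{(c)}/ℚ) = 0`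
  (and for the model `E^{(d_K)}`): the tree's comparison map
  `Sel_{p^∞}(E/ℚ) × Sel_{p^∞}(E^{(c)}/ℚ) → Sel_{p^∞}(E/K)` of T. Dokchitser's quadratic descent
  (`Literature/…/BSDSelmerParityDokchitserBaseChangeProofs`, Dokchitser–Dokchitser 2010 Lemma 4.14) has
  kernel killed by `8` (`nsmul_eq_zero_of_comparisonMap_eq_zero`), and a `p`-primary element killed by
  `8` is `0` for `p` odd (`eq_zero_of_eight_nsmul_of_pow_nsmul`) — at odd `p` the comparison map is
  INJECTIVE, so the two `ℚ`-Selmer groups embed in `Sel_{p^∞}(E/K)`;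
* `selmerCorank_eq_zero_of_selmerGroupPInfty_eq_bot`, `finite_point_of_selmerGroupPInfty_eq_bot`-free
  corank currency: `Sel_{p^∞} = 0 ⟹ corank_{ℤ_p} Sel_{p^∞} = 0` (the hypothesis currency of Skinner's
  clause (2), `Skinner2016.thmC_one_le_selmerCorank_of_L_one_eq_zero`);
* the assembled form used downstream: `selmerGroupPInfty_rat_and_twist_eq_bot_of_selmerGroup_baseChange_eq_bot`
  — `Sel^{(p)}(E/K) = 0` (finite level, the GP2@3-RATIONAL currency) ⟹ both `p^∞`-Selmer groups over
  `ℚ` vanish and both coranks are `0`.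

HONEST FRAMING. Elementary descent bookkeeping over the tree's Selmer library; nothing is booked, no
class moves; closes nothing (T7). PARTITION: O2@3 (B10) × A1 × crux 19574 × stub S1, first-floor brick
R7 (E′-side) — proves-glue.

References: [cite: DokchitserDokchitserAnnals2010, Lemma 4.14 (proof)] [cite: Dokchitser2013ParityNotes, §4]
[cite: SilvermanAEC2009, Thm X.4.2] [cite: Greenberg1999LNM, §1 p. 54, §2 p. 63] [cite: WZhang2014, Thm. 7.1 (proof)].
-/

noncomputable section

open scoped Classical

namespace Summit.BirchSwinnertonDyer.Rank1Residual.X11b.Three.Koly.RationalLift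

open WeierstrassCurve Literature.NumberTheory.EllipticCurves Literature.NumberTheory.QuadraticFields

/-! ## §1 `Sel^{(p)} = 0 ⟹ Sel_{p^∞} = 0` over a number field -/

section Primary

variable {F : Type} [Field F] [NumberField F] (X : WeierstrassCurve F) [X.IsElliptic] (p : ℕ) [Fact p.Prime]

omit [X.IsElliptic] [Fact p.Prime] in
/-- **A `p^∞`-Selmer group without `p`-torsion is trivial**: `Sel_{p^∞}(E/F) ⊆ H¹(F, E[p^∞])` is
`p`-primary (`exists_pow_nsmul_eq_zero_galH1Primary`), so if every Selmer class killed by `p` is `0`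
then, by induction on the exponent, every Selmer class is `0`. [cite: Greenberg1999LNM, §1 p. 54] -/
theorem selmerGroupPInfty_eq_bot_of_forall_nsmul_eq_zero
    (h : ∀ x ∈ selmerGroupPInfty X p, p • x = 0 → x = 0) : selmerGroupPInfty X p = ⊥ := by
  rw [eq_bot_iff]
  intro x hx
  rw [AddSubgroup.mem_bot]
  obtain ⟨k, hk⟩ := exists_pow_nsmul_eq_zero_galH1Primary X p x
  induction k with
  | zero => simpa only [pow_zero, one_smul] using hk
  | succ k ih =>
    have hk' : p • (p ^ k • x) = 0 := by rw [smul_smul, ← pow_succ', hk]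
    exact ih (h _ (AddSubgroup.nsmul_mem _ hx _) hk')

/-- **`Sel^{(p)}(E/F) = 0 ⟹ Sel_{p^∞}(E/F) = 0`** (elliptic curve over a number field `F`, `p`
prime): a `p`-torsion class of `Sel_{p^∞}` is the image of a class of the finite-level Selmer group
`Sel^{(p)}` (tree `exists_mem_selmerGroup_torsionToPrimaryH1_eq`, Silverman X.4.2 / Greenberg §2),
hence `0`; then `selmerGroupPInfty_eq_bot_of_forall_nsmul_eq_zero`. This is the first sentence of the
printed proofs "if the `p`-Selmer group is trivial then so is the `p^∞`-Selmer group"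
(Bhargava–Skinner–Zhang Thm. 5; W. Zhang 2014 Thm. 7.1 reads `Sel_𝔭(A/K) = 0` as `Sel_{𝔭^∞} = 0`).
[cite: SilvermanAEC2009, Thm X.4.2] [cite: Greenberg1999LNM, §2 p. 63] -/
theorem selmerGroupPInfty_eq_bot_of_selmerGroup_eq_bot (h : selmerGroup X (p : ℤ) = ⊥) :
    selmerGroupPInfty X p = ⊥ := by
  refine selmerGroupPInfty_eq_bot_of_forall_nsmul_eq_zero X p fun x hx hpx ↦ ?_
  obtain ⟨y, hy, rfl⟩ :=
    exists_mem_selmerGroup_torsionToPrimaryH1_eq X p X.zsmul_geomPoints_surjective_holds hx hpx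
  rw [h, AddSubgroup.mem_bot] at hy
  rw [hy, map_zero]

/-- **`Sel_{p^∞}(E/F) = 0 ⟹ corank_{ℤ_p} Sel_{p^∞}(E/F) = 0`** (a trivial group is finite;
tree `finite_selmerGroupPInfty_iff_selmerCorank_eq_zero`) — the hypothesis currency of the rank-`0`
`p`-converse theorems (Skinner 2016 Thm. C clause (2)). [cite: Greenberg1999LNM, §1 pp. 54–57] -/
theorem selmerCorank_eq_zero_of_selmerGroupPInfty_eq_bot (h : selmerGroupPInfty X p = ⊥) :
    X.selmerCorank p = 0 := by
  have : Finite (selmerGroupPInfty X p) := by rw [h]; infer_instance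
  exact (finite_selmerGroupPInfty_iff_selmerCorank_eq_zero X p).1 this

end Primary

/-! ## §2 Odd `p`: `Sel_{p^∞}(E/K) = 0 ⟹ Sel_{p^∞}(E/ℚ) = 0 ∧ Sel_{p^∞}(E^{(c)}/ℚ) = 0` for `K = ℚ(√c)` -/

section OddDescent

variable (W : WeierstrassCurve ℚ) (K : Type) [Field K] [NumberField K] (h2 : Module.finrank ℚ K = 2)
  {θ : K} {c : ℚ} (hθ : θ ∉ Set.range (algebraMap ℚ K)) (hc : θ ^ 2 = algebraMap ℚ K c)
  (p : ℕ) [Fact p.Prime] (hp2 : p ≠ 2)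

include h2 hθ hc hp2 in
/-- **At an odd prime the comparison map of the quadratic descent is injective**: for `K = ℚ(θ)`,
`θ² = c`, the map `Φ : Sel_{p^∞}(E/ℚ) × Sel_{p^∞}(E^{(c)}/ℚ) → Sel_{p^∞}(E/K)`,
`(η, η′) ↦ res η + ψ_* res η′` (`comparisonMap`) has kernel killed by `8`
(`nsmul_eq_zero_of_comparisonMap_eq_zero`, Dokchitser–Dokchitser 2010 Lemma 4.14); its source is
`p`-primary, and an element killed by `8` and by a power of the odd prime `p` is `0`.
[cite: DokchitserDokchitserAnnals2010, Lemma 4.14 (proof)] -/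
theorem comparisonMap_injective_of_odd : Function.Injective (comparisonMap W K hθ hc p) := by
  have hp : p.Prime := Fact.out
  refine (injective_iff_map_eq_zero _).mpr fun x hx ↦ ?_
  have h8 := nsmul_eq_zero_of_comparisonMap_eq_zero W K h2 hθ hc p x hx
  obtain ⟨k₁, hk₁⟩ := exists_pow_nsmul_eq_zero_galH1Primary W p (x.1 : galH1Primary W p)
  obtain ⟨k₂, hk₂⟩ := exists_pow_nsmul_eq_zero_galH1Primary (W.quadraticTwist c) p
    (x.2 : galH1Primary (W.quadraticTwist c) p)
  -- componentwise: each component is killed by `8` and by a power of `p`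
  have h81 : 8 • x.1 = 0 := congrArg Prod.fst h8
  have h82 : 8 • x.2 = 0 := congrArg Prod.snd h8
  have hk₁' : p ^ k₁ • x.1 = 0 :=
    Subtype.ext (by rw [AddSubmonoidClass.coe_nsmul, hk₁, ZeroMemClass.coe_zero])
  have hk₂' : p ^ k₂ • x.2 = 0 :=
    Subtype.ext (by rw [AddSubmonoidClass.coe_nsmul, hk₂, ZeroMemClass.coe_zero])
  exact Prod.ext (eq_zero_of_eight_nsmul_of_pow_nsmul hp hp2 h81 hk₁')
    (eq_zero_of_eight_nsmul_of_pow_nsmul hp hp2 h82 hk₂')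

include h2 hθ hc hp2 in
/-- **`Sel_{p^∞}(E/K) = 0 ⟹ Sel_{p^∞}(E/ℚ) = 0` at an odd prime `p`** (`K/ℚ` quadratic): restriction
embeds `Sel_{p^∞}(E/ℚ)` into `Sel_{p^∞}(E/K)` up to the kernel of the comparison map, which is trivial at
odd `p` (`comparisonMap_injective_of_odd`). [cite: DokchitserDokchitserAnnals2010, Lemma 4.14 (proof)] -/
theorem selmerGroupPInfty_eq_bot_of_baseChange (h : selmerGroupPInfty (W.baseChange K) p = ⊥) :
    selmerGroupPInfty W p = ⊥ := by
  rw [eq_bot_iff]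
  intro η hη
  rw [AddSubgroup.mem_bot]
  set x : selmerGroupPInfty W p × selmerGroupPInfty (W.quadraticTwist c) p := (⟨η, hη⟩, 0) with hxdef
  have hx : comparisonMap W K hθ hc p x = 0 := by
    apply Subtype.ext
    have hmem := AddSubgroup.mem_bot.mp (h.le (comparisonMap W K hθ hc p x).2)
    rw [hmem, ZeroMemClass.coe_zero]
  have hx0 := comparisonMap_injective_of_odd W K h2 hθ hc p hp2 (hx.trans (map_zero _).symm)
  have := congrArg (fun z ↦ ((z.1 : selmerGroupPInfty W p) : galH1Primary W p)) hx0
  simpa only [hxdef, Prod.fst_zero, ZeroMemClass.coe_zero] using this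

include h2 hθ hc hp2 in
/-- **`Sel_{p^∞}(E/K) = 0 ⟹ Sel_{p^∞}(E^{(c)}/ℚ) = 0` at an odd prime `p`** (`K = ℚ(θ)`, `θ² = c`):
the twist factor of the comparison map — restriction of `E^{(c)}` to `K` followed by the twist
isomorphism `E^{(c)}_K ≅ E_K` — is likewise injective at odd `p`. "`E_α ≅ E` over `K(√α)`, with the
Galois action twisted by the quadratic character" (T. Dokchitser 2013, §4).
[cite: Dokchitser2013ParityNotes, §4, proof of the Theorem "[Squarity, NekIV, Kurast]"]
[cite: DokchitserDokchitserAnnals2010, Lemma 4.14 (proof)] -/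
theorem selmerGroupPInfty_quadraticTwist_eq_bot_of_baseChange
    (h : selmerGroupPInfty (W.baseChange K) p = ⊥) :
    selmerGroupPInfty (W.quadraticTwist c) p = ⊥ := by
  rw [eq_bot_iff]
  intro η hη
  rw [AddSubgroup.mem_bot]
  set x : selmerGroupPInfty W p × selmerGroupPInfty (W.quadraticTwist c) p := (0, ⟨η, hη⟩) with hxdef
  have hx : comparisonMap W K hθ hc p x = 0 := by
    apply Subtype.ext
    have hmem := AddSubgroup.mem_bot.mp (h.le (comparisonMap W K hθ hc p x).2)
    rw [hmem, ZeroMemClass.coe_zero]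
  have hx0 := comparisonMap_injective_of_odd W K h2 hθ hc p hp2 (hx.trans (map_zero _).symm)
  have := congrArg (fun z ↦ ((z.2 : selmerGroupPInfty (W.quadraticTwist c) p) :
    galH1Primary (W.quadraticTwist c) p)) hx0
  simpa only [hxdef, Prod.snd_zero, ZeroMemClass.coe_zero] using this

/-- **Transport of `Sel_{p^∞} = 0` along an admissible change of variables** `V • W₁ = W₂` over a number
field (Selmer groups are attached to `E`, not to an equation; tree `h1PrimaryIso`,
`mem_selmerGroupPInfty_iff_h1PrimaryIso_mem`). [cite: SilvermanAEC2009, X.§4] -/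
theorem selmerGroupPInfty_eq_bot_of_variableChange {F : Type} [Field F] [NumberField F]
    {W₁ W₂ : WeierstrassCurve F} {V : VariableChange F} (hV : V • W₁ = W₂) (q : ℕ)
    (h : selmerGroupPInfty W₁ q = ⊥) : selmerGroupPInfty W₂ q = ⊥ := by
  rw [eq_bot_iff]
  intro t ht
  rw [AddSubgroup.mem_bot]
  have hs : (h1PrimaryIso q hV).symm t ∈ selmerGroupPInfty W₁ q := by
    rw [mem_selmerGroupPInfty_iff_h1PrimaryIso_mem q hV, AddEquiv.apply_symm_apply]
    exact ht
  rw [h, AddSubgroup.mem_bot, AddEquiv.symm_apply_eq, map_zero] at hs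
  exact hs

include h2 hθ hc hp2 in
/-- **`Sel_{p^∞}(E/K) = 0 ⟹ Sel_{p^∞}(E^{(d_K)}/ℚ) = 0` at an odd prime `p`**, on the model
`W^{(d_K)}` of the twist by the field discriminant: `d_K = c q²` (`NumberField.exists_discr_eq_mul_sq`), so
`E^{(d_K)} ≅ E^{(c)}` over `ℚ` (`exists_variableChange_quadraticTwist_mul_sq`) and
`selmerGroupPInfty_quadraticTwist_eq_bot_of_baseChange` transports
(`selmerGroupPInfty_eq_bot_of_variableChange`). [cite: Dokchitser2013ParityNotes, §4] -/
theorem selmerGroupPInfty_quadraticTwist_discr_eq_bot_of_baseChange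
    (h : selmerGroupPInfty (W.baseChange K) p = ⊥) :
    selmerGroupPInfty (W.quadraticTwist (NumberField.discr K : ℚ)) p = ⊥ := by
  obtain ⟨q, hq, hd⟩ := NumberField.exists_discr_eq_mul_sq h2 hθ hc
  obtain ⟨C, hC⟩ := W.exists_variableChange_quadraticTwist_mul_sq c q hq
  rw [← hd] at hC
  exact selmerGroupPInfty_eq_bot_of_variableChange hC p
    (selmerGroupPInfty_quadraticTwist_eq_bot_of_baseChange W K h2 hθ hc p hp2 h)

end OddDescent

/-! ## §3 The assembled descent from the finite-level `K`-Selmer group (the GP2@3-RATIONAL currency) -/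

section Assembled

variable (W : WeierstrassCurve ℚ) [W.IsElliptic] (K : Type) [Field K] [NumberField K]
  (p : ℕ) [Fact p.Prime]

/-- **`Sel^{(p)}(E/K) = 0` over a quadratic field `K`, `p` odd ⟹ `Sel_{p^∞}(E/ℚ) = 0` and
`Sel_{p^∞}(E^{(d_K)}/ℚ) = 0`.** Chain: finite level ⟹ `p^∞` over `K`
(`selmerGroupPInfty_eq_bot_of_selmerGroup_eq_bot`), then the odd-`p` descent along `K = ℚ(θ)`,
`θ² = c` (`Quadratic.exists_sq_eq_algebraMap`; `selmerGroupPInfty_eq_bot_of_baseChange`,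
`selmerGroupPInfty_quadraticTwist_discr_eq_bot_of_baseChange`). This is the passage, in W. Zhang's proof of
Thm. 7.1, from "`Sel_𝔭(A/K) = 0`" to the hypotheses of [SU] Thm. 2 for `A` and `A^K` over `ℚ`, for a
RATIONAL `A = E′` and `𝔭 = p` odd. [cite: WZhang2014, Thm. 7.1 (proof)] [cite: DokchitserDokchitserAnnals2010, Lemma 4.14] -/
theorem selmerGroupPInfty_rat_and_twist_eq_bot_of_selmerGroup_baseChange_eq_bot
    (h2 : Module.finrank ℚ K = 2) (hp2 : p ≠ 2)
    (h : selmerGroup (W.baseChange K) (p : ℤ) = ⊥) :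
    selmerGroupPInfty W p = ⊥ ∧ selmerGroupPInfty (W.quadraticTwist (NumberField.discr K : ℚ)) p = ⊥ := by
  haveI : (W.baseChange K).IsElliptic := by rw [baseChange]; infer_instance
  obtain ⟨θ, c, hθ, hc⟩ := Quadratic.exists_sq_eq_algebraMap (F := ℚ) (K := K) h2
  have hK := selmerGroupPInfty_eq_bot_of_selmerGroup_eq_bot (W.baseChange K) p h
  exact ⟨selmerGroupPInfty_eq_bot_of_baseChange W K h2 hθ hc p hp2 hK,
    selmerGroupPInfty_quadraticTwist_discr_eq_bot_of_baseChange W K h2 hθ hc p hp2 hK⟩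

/-- **Corank currency of the same descent**: `Sel^{(p)}(E/K) = 0`, `K` quadratic, `p` odd ⟹
`corank_{ℤ_p} Sel_{p^∞}(E/ℚ) = 0` and, for every `ℚ`-model `Wd ≅ E^{(d_K)}` (e.g. a globally minimal
one, on which Skinner's Thm. C is stated), `corank_{ℤ_p} Sel_{p^∞}(Wd/ℚ) = 0`
(`selmerGroupPInfty_eq_bot_of_variableChange`, `selmerCorank_eq_zero_of_selmerGroupPInfty_eq_bot`).
[cite: WZhang2014, Thm. 7.1 (proof)] [cite: DokchitserDokchitserAnnals2010, Lemma 4.14] -/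
theorem selmerCorank_rat_and_twist_eq_zero_of_selmerGroup_baseChange_eq_bot
    (h2 : Module.finrank ℚ K = 2) (hp2 : p ≠ 2)
    (h : selmerGroup (W.baseChange K) (p : ℤ) = ⊥)
    (Wd : WeierstrassCurve ℚ) [Wd.IsElliptic] (C : VariableChange ℚ)
    (hC : C • W.quadraticTwist (NumberField.discr K : ℚ) = Wd) :
    selmerGroupPInfty W p = ⊥ ∧ selmerGroupPInfty Wd p = ⊥ ∧
      W.selmerCorank p = 0 ∧ Wd.selmerCorank p = 0 := by
  obtain ⟨hW, htw⟩ :=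
    selmerGroupPInfty_rat_and_twist_eq_bot_of_selmerGroup_baseChange_eq_bot W K p h2 hp2 h
  have hWd := selmerGroupPInfty_eq_bot_of_variableChange hC p htw
  exact ⟨hW, hWd, selmerCorank_eq_zero_of_selmerGroupPInfty_eq_bot W p hW,
    selmerCorank_eq_zero_of_selmerGroupPInfty_eq_bot Wd p hWd⟩

end Assembled

end Summit.BirchSwinnertonDyer.Rank1Residual.X11b.Three.Koly.RationalLift

end
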